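import Summits.BirchSwinnertonDyer.Rank1Residual.Ordinary.SingularQuotientPairing
import Summits.BirchSwinnertonDyer.Rank1Residual.Ordinary.DepthLawReciprocitySkeleton
import HarnessLib

/-!
# Step (iii) of the depth-law derivation FROM POITOU–TATE: the two-term reciprocity and the skeleton's datum
# `Bl xl yl + Bp xp yp = 0` on the real `H¹(K, E[p^k])` (theorems only — no named fact, no `sorry`;
# nothing about any curve's BSD; C-16 stays a CONJECTURE)

HONEST FRAMING (cell `b2b-bsdres`, run/shared/lean/b2b/bsd-rank1-residual/, verbatim in every
file): the goal of the cell is to DELETE the COMBINATION-SHAPED residual classes of the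
Birch–Swinnerton-Dyer formula for ALL analytic-rank `≤ 1` elliptic curves over `ℚ` — "full BSD
formula for every rank `≤ 1` curve in class `C`" assembled STRICTLY from published theorems — so
that the rank-`≤ 1` remainder becomes exactly the CONSTRUCTION-SHAPED classes, which are TYPED
(missing-input `Prop`s), NOT attempted. This is not "finishing BSD". Seat `b2b-bsdres-additive-p3`
(X8 prover B / X7 joint; typer-designate for the cell conjecture C-16 = hyp C120.1 by hyp R-16 (e)).
This file books nothing and moves no mark; X7 / X8 stay CONSTRUCTION-SHAPED. CONDITIONAL inputs are
DISPLAYED hypotheses: a Poitou–Tate family (`LocalInvariants.SumLocalTermEqZero`, `inv_v` injective) and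
Tate's count `#H¹(K_v, E[n]) = #𝓛_v²`, resp. the two NAMED FACTS `poitouTate_sum_localTatePairing_eq_zero K`
(Milne I Thm. 4.10(b), Cor. 2.3) and `localEulerPoincareCharacteristic K_v` (Milne I Thm. 2.8) in the
`_of_facts` forms — published theorems, typed in `Literature/`.

## What this file does (`R1-DEPTH-LAW.md` §2 (iii), with the comparison part of (ii))

The skeleton `Ordinary.min_eq_min_of_reciprocity` (file `DepthLawReciprocitySkeleton`) derived the depth law's
displayed equation `min(n, a + 2v) = min(n, s + m_p)` from per-level DATA taken as hypotheses: perfect pairings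
`Bl`, `Bp` on `ℤ/p^n`, classes `xl, yl, xp, yp` with RECIPROCITY `Bl xl yl + Bp xp yp = 0` ("`inv_ℓ = −inv_p`",
reciprocity for `Br K`), and three local orders. This file PRODUCES `Bl, Bp, hrec` on the tree's objects:

* §4 **two-term reciprocity** (`invWeilPairing_localization_add_eq_zero`): for a family `inv` with the
  Poitou–Tate vanishing, `x ∈ H¹(K, E[n])` Kummer outside `{v₁, v₂}` (`kummerOutside W n {v₁, v₂}` — a
  Kolyvagin-system class: Kummer away from `{ℓ, p}`) and `P ∈ E(K)`:
  `inv_{v₁}(loc x ∪ₑ loc κP) + inv_{v₂}(loc x ∪ₑ loc κP) = 0` (every other local term dies by the Poonen–Rains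
  isotropy; the tree's `sum_inv_weilCupProduct_localization_eq_zero`); likewise against any `n`-Selmer class;
  **the skeleton's datum** (`exists_singular_identifications_reciprocity`): with `inv_{v_i}` injective, Tate's
  count at `v₁, v₂` and identifications `φ_i : E(K_{v_i}) ↠ ℤ/n` (kernel `n·E`), there are identifications
  `ψ_i : H¹(K_{v_i}, E[n]) ⧸ 𝓛_{v_i} ≅ ℤ/n`, INDEPENDENT of `x` and `P`, with
  `ψ₁[loc x]·φ₁(P_{v₁}) + ψ₂[loc x]·φ₂(P_{v₂}) = 0` (and the Kummer-side form `_kummer` with `φ_i : 𝓛_{v_i} ≅ ℤ/n`);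
  `_of_facts`: from the two named facts, with `Bl = Bp =` multiplication (`B(1,1) = 1`, perfect) — the hypotheses
  `hBl, hBp, hrec` of the skeleton, produced;
* §5 **consumer** (`exists_singular_identification_min_eq_min_of_facts`, Kummer side): from the two named facts,
  identifications `φ_ℓ : 𝓛_ℓ ≅ ℤ/p^k`, `φ_𝔭 : 𝓛_𝔭 ≅ ℤ/p^k`, a class `x` Kummer outside `{ℓ, 𝔭}`, ANY additive
  isomorphism `θ : 𝓛_ℓ ≅ H¹ ⧸ 𝓛_ℓ` (the shape of `φ^{fs}_ℓ`) and finite class `y` with `[loc_ℓ x] = θ y` (the KS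
  relation), and the three local orders (`ord φ_ℓ(y) = min(k, a+v)`, `ord φ_ℓ(loc_ℓ κP) = min(k, v)`,
  `ord φ_𝔭(loc_𝔭 κP) = min(k, m)`): **`min(k, a + 2v) = min(k, ord ψ_𝔭[loc_𝔭 x] + m)`** — `R1-DEPTH-LAW.md` §2 (iii)'s
  equation with `s = ord loc^s_𝔭 x`; reciprocity, perfectness and the comparison's effect on orders DISCHARGED
  (orders are identification-blind: `SingularQuotientPairing.zmodPowOrd_comparison_eq`).

What remains an input of the derivation after this file (per level): the Kolyvagin-system class itself
(`x = κ_ℓ ∈ kummerOutside W (p^k) {ℓ, 𝔭}` with the KS relation to `κ₁ = κ(p^a u·P)`, `a = m_p + FLOOR` — Kato +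
Mazur–Rubin 3.2.4 / 5.2.12), Kim's reading `ord_p δ̃_ℓ = ord loc^s_p κ_ℓ` (Thm. 3.13), and the currency
dictionaries `E(K_ℓ)/p^k ≅ Ẽ(𝔽_ℓ)/p^k`, `E(ℚ_v) ≅ E(ℚ_[p])` (consumer over `ℚ` on C-16's letter:
`Ordinary/Conjectures/KuriharaExactOrderFromPoitouTate.lean`).

References: J. S. Milne, *Arithmetic Duality Theorems* (2006), I Cor. 2.3, Thm. 2.8, Thm. 4.10(b)
[MilneADT2006]; B. Mazur, K. Rubin, *Kolyvagin systems*, Mem. AMS 799 (2004), Def. 1.2.2, Thm. 3.2.4, Thm. 5.2.12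
[MazurRubin2004]; B. Poonen, E. Rains (2012), Prop. 4.10 [PoonenRains2012]; C.-H. Kim, arXiv:2203.12159, Thm. 3.13
[Kim2022StructureSelmer]; `R1-DEPTH-LAW.md` §2.
-/

noncomputable section

open scoped Classical


namespace Summit.BirchSwinnertonDyer.Rank1Residual.Ordinary.ReciprocityPT

open Function
open Summit.BirchSwinnertonDyer.Rank1Residual.X11b.FiniteDuality

section Reciprocity

open WeierstrassCurve Literature.NumberTheory.EllipticCurves Literature.NumberTheory.GaloisRepresentations
  Literature.NumberTheory.GaloisCohomology Field NumberField IsDedekindDomain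
open Literature.NumberTheory.GaloisRepresentations.DiscreteGaloisModule (mu MuCarrier)
open Summit.BirchSwinnertonDyer.Rank1Residual.X11b.Relaxation
open scoped ContRepresentation

variable {K : Type} [Field K] [NumberField K] (W : WeierstrassCurve K) [W.IsElliptic]
variable (n : ℕ) [NeZero n]
variable (e : geomTorsion W n → geomTorsion W n → AlgebraicClosure K)
  (hμ : ∀ S T, e S T ^ n = 1)
  (hadd₁ : ∀ S₁ S₂ T, e (S₁ + S₂) T = e S₁ T * e S₂ T)
  (hadd₂ : ∀ S T₁ T₂, e S (T₁ + T₂) = e S T₁ * e S T₂)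
  (hgal : ∀ (σ : absoluteGaloisGroup K) (S T : geomTorsion W n), σ • e S T = e (σ • S) (σ • T))
  (halt : ∀ T, e T T = 1) (hnondeg : ∀ T, (∀ S, e S T = 1) → T = 0)
  (inv : LocalInvariants K n)

/-! ### §4 Reciprocity: the two-term form of Poitou–Tate, and the skeleton's datum -/

omit [W.IsElliptic] [NeZero n] in
/-- **For odd `n` the Kummer condition at the infinite places is automatic** (`H¹(K_w, E[n]) = 0`, Milne I Rem. 3.7,
tree `galoisCohomology_one_torsion_eq_zero_infinitePlace_of_odd`): a class is Kummer outside `S` iff it is Kummer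
at every FINITE place outside `S` — the form in which a Kolyvagin-system class (conditions at finite places only)
meets the hypothesis `x ∈ kummerOutside W n {ℓ, p}` below. [cite: MilneADT2006, I Rem. 3.7] -/
theorem mem_kummerOutside_iff_finite_of_odd (hodd : Odd n) (S : Finset (Place K))
    (x : galoisCohomology (W.torsionGaloisModule (n : ℤ)) 1) :
    x ∈ kummerOutside W n S ↔ ∀ v : HeightOneSpectrum (𝓞 K), (Sum.inr v : Place K) ∉ S →
      galoisCohomology.localization (W.torsionGaloisModule n) (Sum.inr v) 1 x ∈
        W.kummerSelmerStructure n (Sum.inr v) := by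
  rw [mem_kummerOutside_iff]
  refine ⟨fun h v hv => h (Sum.inr v) hv, fun h v hv => ?_⟩
  rcases v with w | v
  · have h0 : galoisCohomology.res (W.torsionGaloisModule (n : ℤ)) (Place.Completion (Sum.inl w : Place K)) 1 x
        = 0 :=
      galoisCohomology_one_torsion_eq_zero_infinitePlace_of_odd W w hodd.natCast _
    rw [h0]
    exact AddSubgroup.zero_mem _
  · exact h v hv

include halt in
/-- **TWO-TERM RECIPROCITY.** If the family `inv` satisfies the Poitou–Tate vanishing (`SumLocalTermEqZero`,
the content of the named fact `poitouTate_sum_localTatePairing_eq_zero`), then for every class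
`x ∈ H¹(K, E[n])` satisfying the Kummer condition at every place `∉ {v₁, v₂}` (`x ∈ kummerOutside W n {v₁, v₂}`
— the shape of a Kolyvagin-system class `κ_ℓ` for the structure "Kummer away from `p`, anything at `p`,
transverse at `ℓ`", with `{v₁, v₂} = {ℓ, p}`) and every `P ∈ E(K)`:
`inv_{v₁}(loc x ∪ₑ loc κP) + inv_{v₂}(loc x ∪ₑ loc κP) = 0` — all other local terms vanish by the isotropy
of the Kummer conditions. This is `R1-DEPTH-LAW.md` §2 (iii) "`Σ_w inv_w = 0` … `inv_ℓ = −inv_p`" on the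
tree's real `H¹(K, E[n])`. [cite: MilneADT2006, Ch. I, Thm. 4.10(b)] [cite: PoonenRains2012, Prop. 4.10] -/
theorem invWeilPairing_localization_add_eq_zero (hPT : inv.SumLocalTermEqZero) {v₁ v₂ : Place K}
    (hne : v₁ ≠ v₂) {x : galoisCohomology (W.torsionGaloisModule (n : ℤ)) 1}
    (hx : x ∈ kummerOutside W n {v₁, v₂}) (P : W.toAffine.Point) :
    invWeilPairing W n e hμ hadd₁ hadd₂ hgal inv v₁
        (galoisCohomology.localization (W.torsionGaloisModule n) v₁ 1 x)
        (galoisCohomology.localization (W.torsionGaloisModule n) v₁ 1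
          (kummerMapTorsion W n (W.zsmul_geomPoints_surjective_holds
            (Int.natCast_ne_zero.mpr (NeZero.ne n))) P)) +
      invWeilPairing W n e hμ hadd₁ hadd₂ hgal inv v₂
        (galoisCohomology.localization (W.torsionGaloisModule n) v₂ 1 x)
        (galoisCohomology.localization (W.torsionGaloisModule n) v₂ 1
          (kummerMapTorsion W n (W.zsmul_geomPoints_surjective_holds
            (Int.natCast_ne_zero.mpr (NeZero.ne n))) P)) = 0 := by
  have h := sum_inv_weilCupProduct_localization_eq_zero W n e hμ hadd₁ hadd₂ hgal inv hPT x
    (kummerMapTorsion W n (W.zsmul_geomPoints_surjective_holds (Int.natCast_ne_zero.mpr (NeZero.ne n))) P)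
    {v₁, v₂} fun v hv =>
      invWeilPairing_eq_zero_of_mem W n e hμ hadd₁ hadd₂ hgal halt inv v
        (show galoisCohomology.localization (W.torsionGaloisModule n) v 1 x ∈ W.kummerSelmerStructure n v from
          (mem_kummerOutside_iff W n {v₁, v₂} x).mp hx v hv)
        (localization_kummerMapTorsion_mem W n v P)
  rwa [Finset.sum_pair hne] at h

include halt in
/-- The same against ANY `n`-Selmer class `y ∈ Sel⁽ⁿ⁾(E/K)` (Kummer at every place) in place of `κ(P)`:
`inv_{v₁}(loc x ∪ₑ loc y) + inv_{v₂}(loc x ∪ₑ loc y) = 0`. [cite: MilneADT2006, Ch. I, Thm. 4.10(b)] -/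
theorem invWeilPairing_localization_add_eq_zero_of_mem_selmerGroup (hPT : inv.SumLocalTermEqZero)
    {v₁ v₂ : Place K} (hne : v₁ ≠ v₂) {x y : galoisCohomology (W.torsionGaloisModule (n : ℤ)) 1}
    (hx : x ∈ kummerOutside W n {v₁, v₂}) (hy : y ∈ selmerGroup W (n : ℤ)) :
    invWeilPairing W n e hμ hadd₁ hadd₂ hgal inv v₁
        (galoisCohomology.localization (W.torsionGaloisModule n) v₁ 1 x)
        (galoisCohomology.localization (W.torsionGaloisModule n) v₁ 1 y) +
      invWeilPairing W n e hμ hadd₁ hadd₂ hgal inv v₂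
        (galoisCohomology.localization (W.torsionGaloisModule n) v₂ 1 x)
        (galoisCohomology.localization (W.torsionGaloisModule n) v₂ 1 y) = 0 := by
  have h := sum_inv_weilCupProduct_localization_eq_zero W n e hμ hadd₁ hadd₂ hgal inv hPT x y {v₁, v₂}
    fun v hv =>
      invWeilPairing_eq_zero_of_mem W n e hμ hadd₁ hadd₂ hgal halt inv v
        (show galoisCohomology.localization (W.torsionGaloisModule n) v 1 x ∈ W.kummerSelmerStructure n v from
          (mem_kummerOutside_iff W n {v₁, v₂} x).mp hx v hv)
        ((W.mem_selmerGroup_iff_forall_localization_mem (n : ℤ) y).mp hy v)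
  rwa [Finset.sum_pair hne] at h

include hμ hadd₁ hadd₂ hgal halt hnondeg in
/-- **THE SKELETON'S RECIPROCITY DATUM, Kummer side.** Let `v₁ ≠ v₂` be finite places (read `ℓ` and `p`), `inv` a
family with the Poitou–Tate vanishing and `inv_{v_i}` injective, Tate's count `#H¹(K_{v_i}, E[n]) = #𝓛_{v_i}²` at
both, and identifications `φ_i : 𝓛_{v_i} ≅ ℤ/n` of the two FINITE parts (Kummer conditions). Then there are
identifications `ψ_i : H¹(K_{v_i}, E[n]) ⧸ 𝓛_{v_i} ≅ ℤ/n` of the SINGULAR quotients — depending on `inv`, the Weil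
pairing and the `φ_i` only — such that for EVERY class `x` Kummer outside `{v₁, v₂}` and EVERY `P ∈ E(K)`:
`ψ₁[loc_{v₁} x] · φ₁(loc_{v₁} κP) + ψ₂[loc_{v₂} x] · φ₂(loc_{v₂} κP) = 0`. [cite: MilneADT2006, Ch. I, Thm. 4.10(b), Cor. 2.3]
[cite: MazurRubin2004, Thm. 5.2.12] -/
theorem exists_singular_identifications_reciprocity_kummer (hPT : inv.SumLocalTermEqZero)
    {v₁ v₂ : HeightOneSpectrum (𝓞 K)} (hne : v₁ ≠ v₂)
    (hinv₁ : Injective (inv (Sum.inr v₁))) (hinv₂ : Injective (inv (Sum.inr v₂)))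
    (hE₁ : Nat.card (galoisCohomology ((W.torsionGaloisModule n).toLocal (Sum.inr v₁)) 1) =
      (Nat.card (nsmulAddMonoidHom n : (W.baseChange (v₁.adicCompletion K)).toAffine.Point →+ _).ker *
        Nat.card (v₁.adicCompletionIntegers K ⧸ Ideal.span {(n : v₁.adicCompletionIntegers K)})) ^ 2)
    (hE₂ : Nat.card (galoisCohomology ((W.torsionGaloisModule n).toLocal (Sum.inr v₂)) 1) =
      (Nat.card (nsmulAddMonoidHom n : (W.baseChange (v₂.adicCompletion K)).toAffine.Point →+ _).ker *
        Nat.card (v₂.adicCompletionIntegers K ⧸ Ideal.span {(n : v₂.adicCompletionIntegers K)})) ^ 2)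
    (φ₁ : W.kummerSelmerStructure (n : ℤ) (Sum.inr v₁) ≃+ ZMod n)
    (φ₂ : W.kummerSelmerStructure (n : ℤ) (Sum.inr v₂) ≃+ ZMod n) :
    ∃ (ψ₁ : galoisCohomology ((W.torsionGaloisModule n).toLocal (Sum.inr v₁)) 1 ⧸
          W.kummerSelmerStructure (n : ℤ) (Sum.inr v₁) ≃+ ZMod n)
      (ψ₂ : galoisCohomology ((W.torsionGaloisModule n).toLocal (Sum.inr v₂)) 1 ⧸
          W.kummerSelmerStructure (n : ℤ) (Sum.inr v₂) ≃+ ZMod n),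
      ∀ x ∈ kummerOutside W n {Sum.inr v₁, Sum.inr v₂}, ∀ P : W.toAffine.Point,
        ψ₁ (galoisCohomology.localization (W.torsionGaloisModule n) (Sum.inr v₁) 1 x) *
            φ₁ ⟨_, localization_kummerMapTorsion_mem W n (Sum.inr v₁) P⟩ +
          ψ₂ (galoisCohomology.localization (W.torsionGaloisModule n) (Sum.inr v₂) 1 x) *
            φ₂ ⟨_, localization_kummerMapTorsion_mem W n (Sum.inr v₂) P⟩ = 0 := by
  obtain ⟨ψ₁, hψ₁⟩ := exists_addEquiv_singular_pairing_eq_mul W n e hμ hadd₁ hadd₂ hgal halt hnondeg inv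
    v₁ hinv₁ hE₁ φ₁
  obtain ⟨ψ₂, hψ₂⟩ := exists_addEquiv_singular_pairing_eq_mul W n e hμ hadd₁ hadd₂ hgal halt hnondeg inv
    v₂ hinv₂ hE₂ φ₂
  refine ⟨ψ₁, ψ₂, fun x hx P => ?_⟩
  have hrec := invWeilPairing_localization_add_eq_zero W n e hμ hadd₁ hadd₂ hgal halt inv hPT
    (Sum.inr_injective.ne hne) hx P
  rwa [hψ₁ _ _ (localization_kummerMapTorsion_mem W n (Sum.inr v₁) P),
    hψ₂ _ _ (localization_kummerMapTorsion_mem W n (Sum.inr v₂) P)] at hrec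

include hμ hadd₁ hadd₂ hgal halt hnondeg in
/-- **THE SKELETON'S RECIPROCITY DATUM ON THE REAL `H¹(K, E[n])`.** Let `v₁ ≠ v₂` be finite places (read
`ℓ` and `p`), `inv` a family with the Poitou–Tate vanishing and `inv_{v_i}` injective, Tate's count
`#H¹(K_{v_i}, E[n]) = #𝓛_{v_i}²` at both, and `φ_i : E(K_{v_i}) ↠ ℤ/n` with kernel `n·E(K_{v_i})`
(identifications of the FINITE parts; they exist iff `E(K_{v_i})/n` is cyclic of order `n`). Then there are
identifications `ψ_i : H¹(K_{v_i}, E[n]) ⧸ 𝓛_{v_i} ≅ ℤ/n` of the SINGULAR quotients — depending on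
`inv`, the Weil pairing and the `φ_i` ONLY — such that for EVERY class `x` Kummer outside `{v₁, v₂}` and
EVERY `P ∈ E(K)`:

  `ψ₁[loc_{v₁} x] · φ₁(P_{v₁}) + ψ₂[loc_{v₂} x] · φ₂(P_{v₂}) = 0`.

With `Bl = Bp =` multiplication on `ℤ/n` (perfect: `B(1,1) = 1`), `xl = ψ₁[loc_ℓ x]`, `yl = φ₁(P_ℓ)`,
`xp = ψ₂[loc_p x]`, `yp = φ₂(P_p)` this is LITERALLY the hypothesis `hrec : Bl xl yl + Bp xp yp = 0` (with
`hBl`, `hBp`) of `Ordinary.min_eq_min_of_reciprocity` / `kuriharaExactOrderAt_of_letter_reciprocity` — i.e.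
step (iii) of `R1-DEPTH-LAW.md` §2 is DISCHARGED on the tree's objects modulo the Poitou–Tate family and
Tate's local count (both PUBLISHED, the tree's named facts) and the cyclicity of the two finite parts.
[cite: MilneADT2006, Ch. I, Thm. 4.10(b), Cor. 2.3, Thm. 2.8] [cite: MazurRubin2004, Thm. 5.2.12] -/
theorem exists_singular_identifications_reciprocity (hPT : inv.SumLocalTermEqZero)
    {v₁ v₂ : HeightOneSpectrum (𝓞 K)} (hne : v₁ ≠ v₂)
    (hinv₁ : Injective (inv (Sum.inr v₁))) (hinv₂ : Injective (inv (Sum.inr v₂)))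
    (hE₁ : Nat.card (galoisCohomology ((W.torsionGaloisModule n).toLocal (Sum.inr v₁)) 1) =
      (Nat.card (nsmulAddMonoidHom n : (W.baseChange (v₁.adicCompletion K)).toAffine.Point →+ _).ker *
        Nat.card (v₁.adicCompletionIntegers K ⧸ Ideal.span {(n : v₁.adicCompletionIntegers K)})) ^ 2)
    (hE₂ : Nat.card (galoisCohomology ((W.torsionGaloisModule n).toLocal (Sum.inr v₂)) 1) =
      (Nat.card (nsmulAddMonoidHom n : (W.baseChange (v₂.adicCompletion K)).toAffine.Point →+ _).ker *
        Nat.card (v₂.adicCompletionIntegers K ⧸ Ideal.span {(n : v₂.adicCompletionIntegers K)})) ^ 2)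
    (φ₁ : (W.baseChange (v₁.adicCompletion K)).toAffine.Point →+ ZMod n) (hφ₁ : Surjective φ₁)
    (hker₁ : ∀ g, φ₁ g = 0 ↔ ∃ h, n • h = g)
    (φ₂ : (W.baseChange (v₂.adicCompletion K)).toAffine.Point →+ ZMod n) (hφ₂ : Surjective φ₂)
    (hker₂ : ∀ g, φ₂ g = 0 ↔ ∃ h, n • h = g) :
    ∃ (ψ₁ : galoisCohomology ((W.torsionGaloisModule n).toLocal (Sum.inr v₁)) 1 ⧸
          W.kummerSelmerStructure (n : ℤ) (Sum.inr v₁) ≃+ ZMod n)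
      (ψ₂ : galoisCohomology ((W.torsionGaloisModule n).toLocal (Sum.inr v₂)) 1 ⧸
          W.kummerSelmerStructure (n : ℤ) (Sum.inr v₂) ≃+ ZMod n),
      ∀ x ∈ kummerOutside W n {Sum.inr v₁, Sum.inr v₂}, ∀ P : W.toAffine.Point,
        ψ₁ (galoisCohomology.localization (W.torsionGaloisModule n) (Sum.inr v₁) 1 x) *
            φ₁ (Affine.Point.baseChange (W' := W) K (v₁.adicCompletion K) P) +
          ψ₂ (galoisCohomology.localization (W.torsionGaloisModule n) (Sum.inr v₂) 1 x) *
            φ₂ (Affine.Point.baseChange (W' := W) K (v₂.adicCompletion K) P) = 0 := by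
  obtain ⟨φL₁, hφL₁⟩ := exists_addEquiv_kummer_of_pointIdentification W n v₁ φ₁ hφ₁ hker₁
  obtain ⟨φL₂, hφL₂⟩ := exists_addEquiv_kummer_of_pointIdentification W n v₂ φ₂ hφ₂ hker₂
  obtain ⟨ψ₁, ψ₂, h⟩ := exists_singular_identifications_reciprocity_kummer W n e hμ hadd₁ hadd₂ hgal halt
    hnondeg inv hPT hne hinv₁ hinv₂ hE₁ hE₂ φL₁ φL₂
  refine ⟨ψ₁, ψ₂, fun x hx P => ?_⟩
  have hrec := h x hx P
  have hk₁ : (⟨_, localization_kummerMapTorsion_mem W n (Sum.inr v₁) P⟩ :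
      W.kummerSelmerStructure (n : ℤ) (Sum.inr v₁)) =
        ⟨_, localKummerMap_mem_kummerSelmerStructure W n v₁
          (Affine.Point.baseChange (W' := W) K (v₁.adicCompletion K) P)⟩ :=
    Subtype.ext (localization_kummerMapTorsion_eq_localKummerMap W n v₁ P)
  have hk₂ : (⟨_, localization_kummerMapTorsion_mem W n (Sum.inr v₂) P⟩ :
      W.kummerSelmerStructure (n : ℤ) (Sum.inr v₂)) =
        ⟨_, localKummerMap_mem_kummerSelmerStructure W n v₂
          (Affine.Point.baseChange (W' := W) K (v₂.adicCompletion K) P)⟩ :=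
    Subtype.ext (localization_kummerMapTorsion_eq_localKummerMap W n v₂ P)
  rw [hk₁, hk₂, hφL₁, hφL₂] at hrec
  exact hrec

/-- **The skeleton's datum FROM THE TWO NAMED FACTS.** For a prime power `n`, the Poitou–Tate fact
(`poitouTate_sum_localTatePairing_eq_zero K`: Milne I Thm. 4.10(b) with Cor. 2.3) and Tate's local
Euler–Poincaré characteristic at `K_{v₁}` and `K_{v₂}` (`localEulerPoincareCharacteristic`, Milne I Thm. 2.8)
give, for any identifications `φ_i : E(K_{v_i}) ↠ ℤ/n` (kernel `n·E(K_{v_i})`), identifications `ψ_i` of the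
singular quotients and PERFECT pairings `Bl`, `Bp` on `ℤ/n` (multiplication; `Bl(1,1) = Bp(1,1) = 1`) with
`Bl (ψ₁[loc_{v₁} x]) (φ₁ P_{v₁}) + Bp (ψ₂[loc_{v₂} x]) (φ₂ P_{v₂}) = 0` for every `x` Kummer outside
`{v₁, v₂}` and every `P ∈ E(K)` — the hypotheses `hBl`, `hBp`, `hrec` of the skeleton
`Ordinary.min_eq_min_of_reciprocity`, produced rather than assumed.
[cite: MilneADT2006, Ch. I, Thm. 4.10(b), Cor. 2.3, Thm. 2.8] [cite: MazurRubin2004, Thm. 5.2.12] -/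
theorem exists_skeletonReciprocityDatum_of_facts (hn : IsPrimePow n)
    (hPT : poitouTate_sum_localTatePairing_eq_zero K) {v₁ v₂ : HeightOneSpectrum (𝓞 K)} (hne : v₁ ≠ v₂)
    (hEP₁ : localEulerPoincareCharacteristic (v₁.adicCompletion K))
    (hEP₂ : localEulerPoincareCharacteristic (v₂.adicCompletion K))
    (φ₁ : (W.baseChange (v₁.adicCompletion K)).toAffine.Point →+ ZMod n) (hφ₁ : Surjective φ₁)
    (hker₁ : ∀ g, φ₁ g = 0 ↔ ∃ h, n • h = g)
    (φ₂ : (W.baseChange (v₂.adicCompletion K)).toAffine.Point →+ ZMod n) (hφ₂ : Surjective φ₂)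
    (hker₂ : ∀ g, φ₂ g = 0 ↔ ∃ h, n • h = g) :
    ∃ (ψ₁ : galoisCohomology ((W.torsionGaloisModule n).toLocal (Sum.inr v₁)) 1 ⧸
          W.kummerSelmerStructure (n : ℤ) (Sum.inr v₁) ≃+ ZMod n)
      (ψ₂ : galoisCohomology ((W.torsionGaloisModule n).toLocal (Sum.inr v₂)) 1 ⧸
          W.kummerSelmerStructure (n : ℤ) (Sum.inr v₂) ≃+ ZMod n)
      (Bl Bp : ZMod n →+ ZMod n →+ ZMod n), IsUnit (Bl 1 1) ∧ IsUnit (Bp 1 1) ∧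
      ∀ x ∈ kummerOutside W n {Sum.inr v₁, Sum.inr v₂}, ∀ P : W.toAffine.Point,
        Bl (ψ₁ (galoisCohomology.localization (W.torsionGaloisModule n) (Sum.inr v₁) 1 x))
            (φ₁ (Affine.Point.baseChange (W' := W) K (v₁.adicCompletion K) P)) +
          Bp (ψ₂ (galoisCohomology.localization (W.torsionGaloisModule n) (Sum.inr v₂) 1 x))
            (φ₂ (Affine.Point.baseChange (W' := W) K (v₂.adicCompletion K) P)) = 0 := by
  haveI : PerfectField K := PerfectField.ofCharZero
  have hn2 : 2 ≤ n := by
    obtain ⟨p, k, hp, hk, rfl⟩ := hn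
    calc 2 ≤ p := (Nat.prime_iff.mpr hp).two_le
      _ = p ^ 1 := (pow_one p).symm
      _ ≤ p ^ k := Nat.pow_le_pow_right (Nat.prime_iff.mpr hp).pos hk
  obtain ⟨e, hμ, hadd₁, hadd₂, halt, hnondeg, hgal⟩ :=
    exists_weilPairing_holds W n hn2 (by exact_mod_cast NeZero.ne n)
  obtain ⟨inv, hperf, hsum⟩ := hPT n
  obtain ⟨ψ₁, ψ₂, h⟩ := exists_singular_identifications_reciprocity W n e hμ hadd₁ hadd₂ hgal halt hnondeg
    inv hsum hne (hperf v₁).1.1 (hperf v₂).1.1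
    (natCard_galoisCohomology_one_torsion_adicCompletion_eq_sq W v₁ n hn hEP₁)
    (natCard_galoisCohomology_one_torsion_adicCompletion_eq_sq W v₂ n hn hEP₂)
    φ₁ hφ₁ hker₁ φ₂ hφ₂ hker₂
  refine ⟨ψ₁, ψ₂, AddMonoidHom.mul, AddMonoidHom.mul, ?_, ?_, fun x hx P => ?_⟩
  · rw [AddMonoidHom.mul_apply, mul_one]; exact isUnit_one
  · rw [AddMonoidHom.mul_apply, mul_one]; exact isUnit_one
  · rw [AddMonoidHom.mul_apply, AddMonoidHom.mul_apply]; exact h x hx P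

end Reciprocity

/-! ### §5 Consumer: the skeleton's conclusion `min(k, a + 2v) = min(k, s + m)` with (iii) DISCHARGED -/

section Consumer

open WeierstrassCurve Literature.NumberTheory.EllipticCurves Literature.NumberTheory.GaloisRepresentations
  Literature.NumberTheory.GaloisCohomology Field NumberField IsDedekindDomain
open Summit.BirchSwinnertonDyer.Rank1Residual.X11b.Relaxation

variable {K : Type} [Field K] [NumberField K] (W : WeierstrassCurve K) [W.IsElliptic] (p k : ℕ)
  [hp : Fact p.Prime]

/-- **STEP (iii) OF THE DEPTH-LAW DERIVATION, DISCHARGED.** Let `ℓ ≠ 𝔭` be finite places of `K`, `p^k` a prime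
power (`k ≥ 1`), and assume the two NAMED FACTS: Poitou–Tate (`poitouTate_sum_localTatePairing_eq_zero K`) and
Tate's local Euler–Poincaré characteristic at `K_ℓ` and `K_𝔭`. Let `φ_ℓ : 𝓛_ℓ ≅ ℤ/p^k`, `φ_𝔭 : 𝓛_𝔭 ≅ ℤ/p^k` be
identifications of the two finite parts (Kummer conditions). Then there is an identification `ψ_𝔭` of the singular
quotient at `𝔭` (`s := ord ψ_𝔭[loc_𝔭 x] = ord loc^s_𝔭 x`, identification-blind) such that for EVERY class
`x ∈ H¹(K, E[p^k])` Kummer outside `{ℓ, 𝔭}` (a Kolyvagin-system class), EVERY `P ∈ E(K)`, EVERY additive isomorphism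
`θ : 𝓛_ℓ ≅ H¹(K_ℓ, E[p^k]) ⧸ 𝓛_ℓ` (the shape of the finite–singular comparison `φ^{fs}_ℓ`, Mazur–Rubin Def. 1.2.2) and
finite class `y ∈ 𝓛_ℓ` with `[loc_ℓ x] = θ y` (the KS relation, `y = loc_ℓ κ₁`, `κ₁ = κ(p^a u·P)`), and all
exponents `a v m` with `ord φ_ℓ(y) = min(k, a + v)`, `ord φ_ℓ(loc_ℓ κP) = min(k, v)`, `ord φ_𝔭(loc_𝔭 κP) = min(k, m)`
(the three LOCAL class orders — `Ordinary/LocalClassOrders.lean`):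
**`min(k, a + 2v) = min(k, ord ψ_𝔭[loc_𝔭 x] + m)`** — the displayed equation of `R1-DEPTH-LAW.md` §2 (iii).
The reciprocity, both perfect pairings and the comparison isomorphism's effect on orders are no longer hypotheses
(`min_eq_min_of_reciprocity` + `exists_singular_identifications_reciprocity_kummer` + `zmodPowOrd_comparison_eq`).
[cite: MilneADT2006, Ch. I, Thm. 4.10(b), Cor. 2.3, Thm. 2.8] [cite: MazurRubin2004, Def. 1.2.2 and Thm. 5.2.12] -/
theorem exists_singular_identification_min_eq_min_of_facts (hk : 0 < k)
    (hPT : poitouTate_sum_localTatePairing_eq_zero K) {ℓ 𝔭 : HeightOneSpectrum (𝓞 K)} (hne : ℓ ≠ 𝔭)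
    (hEPℓ : localEulerPoincareCharacteristic (ℓ.adicCompletion K))
    (hEP𝔭 : localEulerPoincareCharacteristic (𝔭.adicCompletion K))
    (φℓ : W.kummerSelmerStructure ((p ^ k : ℕ) : ℤ) (Sum.inr ℓ) ≃+ ZMod (p ^ k))
    (φ𝔭 : W.kummerSelmerStructure ((p ^ k : ℕ) : ℤ) (Sum.inr 𝔭) ≃+ ZMod (p ^ k)) :
    ∃ (ψ𝔭 : galoisCohomology ((W.torsionGaloisModule (p ^ k : ℕ)).toLocal (Sum.inr 𝔭)) 1 ⧸
          W.kummerSelmerStructure ((p ^ k : ℕ) : ℤ) (Sum.inr 𝔭) ≃+ ZMod (p ^ k)),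
      ∀ x ∈ kummerOutside W (p ^ k) {Sum.inr ℓ, Sum.inr 𝔭}, ∀ (P : W.toAffine.Point)
        (θ : W.kummerSelmerStructure ((p ^ k : ℕ) : ℤ) (Sum.inr ℓ) ≃+
          galoisCohomology ((W.torsionGaloisModule (p ^ k : ℕ)).toLocal (Sum.inr ℓ)) 1 ⧸
            W.kummerSelmerStructure ((p ^ k : ℕ) : ℤ) (Sum.inr ℓ))
        (y : W.kummerSelmerStructure ((p ^ k : ℕ) : ℤ) (Sum.inr ℓ)),
        (galoisCohomology.localization (W.torsionGaloisModule (p ^ k : ℕ)) (Sum.inr ℓ) 1 x :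
            galoisCohomology ((W.torsionGaloisModule (p ^ k : ℕ)).toLocal (Sum.inr ℓ)) 1 ⧸
              W.kummerSelmerStructure ((p ^ k : ℕ) : ℤ) (Sum.inr ℓ)) = θ y →
        ∀ {a v m : ℕ},
          zmodPowOrd p k (φℓ y) = min k (a + v) →
          zmodPowOrd p k (φℓ ⟨_, localization_kummerMapTorsion_mem W (p ^ k) (Sum.inr ℓ) P⟩) = min k v →
          zmodPowOrd p k (φ𝔭 ⟨_, localization_kummerMapTorsion_mem W (p ^ k) (Sum.inr 𝔭) P⟩) = min k m →
          min k (a + 2 * v) =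
            min k (zmodPowOrd p k
              (ψ𝔭 (galoisCohomology.localization (W.torsionGaloisModule (p ^ k : ℕ)) (Sum.inr 𝔭) 1 x)) + m) := by
  haveI : PerfectField K := PerfectField.ofCharZero
  have hn : IsPrimePow (p ^ k) := ⟨p, k, hp.out.prime, hk, rfl⟩
  have hn2 : 2 ≤ p ^ k :=
    le_trans hp.out.two_le (by simpa using Nat.pow_le_pow_right hp.out.pos hk)
  obtain ⟨e, hμ, hadd₁, hadd₂, halt, hnondeg, hgal⟩ :=
    exists_weilPairing_holds W (p ^ k) hn2 (by exact_mod_cast (NeZero.ne (p ^ k)))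
  obtain ⟨inv, hperf, hsum⟩ := hPT (p ^ k)
  obtain ⟨ψℓ, ψ𝔭, hrec⟩ := exists_singular_identifications_reciprocity_kummer W (p ^ k) e hμ hadd₁ hadd₂ hgal
    halt hnondeg inv hsum hne (hperf ℓ).1.1 (hperf 𝔭).1.1
    (natCard_galoisCohomology_one_torsion_adicCompletion_eq_sq W ℓ (p ^ k) hn hEPℓ)
    (natCard_galoisCohomology_one_torsion_adicCompletion_eq_sq W 𝔭 (p ^ k) hn hEP𝔭) φℓ φ𝔭
  refine ⟨ψ𝔭, fun x hx P θ y hKS a v m hxl hyl hyp => ?_⟩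
  have hxl' : zmodPowOrd p k
      (ψℓ (galoisCohomology.localization (W.torsionGaloisModule (p ^ k : ℕ)) (Sum.inr ℓ) 1 x)) =
        min k (a + v) := by
    rw [hKS, zmodPowOrd_comparison_eq hp.out φℓ ψℓ θ y, hxl]
  refine min_eq_min_of_reciprocity hp.out (AddMonoidHom.mul : ZMod (p ^ k) →+ ZMod (p ^ k) →+ ZMod (p ^ k))
    AddMonoidHom.mul (by rw [AddMonoidHom.mul_apply, mul_one]; exact isUnit_one)
    (by rw [AddMonoidHom.mul_apply, mul_one]; exact isUnit_one) hxl' hyl hyp ?_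
  rw [AddMonoidHom.mul_apply, AddMonoidHom.mul_apply]
  exact hrec x hx P

end Consumer


end Summit.BirchSwinnertonDyer.Rank1Residual.Ordinary.ReciprocityPT

end
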